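import Literature.NumberTheory.NumberFields.CyclicQuinticField241Integers
import Literature.NumberTheory.NumberFields.QuinticRing
import Mathlib.NumberTheory.NumberField.ClassNumber
import Mathlib.NumberTheory.NumberField.Ideal.KummerDedekind
import Mathlib.NumberTheory.NumberField.Discriminant.Defs
import Mathlib.LinearAlgebra.Matrix.SchurComplement
import Mathlib.FieldTheory.Finite.Basic
import Mathlib.Topology.Algebra.Polynomial
import Mathlib.Algebra.Algebra.Rat
import HarnessLib

/-!
# The cyclic quintic field of conductor `241`: real places, `d_K = 241⁴`, Dedekind–Kummer away from `176`, prime certificates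

Fourth file on `K = K₂₄₁ = ℚ(η₀)` (`CyclicQuinticField241.lean`, `…Integers.lean`:
`𝓞 K ≅ PeriodRing241 ℤ` on the Gaussian periods). It prepares the class-number-one certificate
(`CyclicQuinticField241ClassNumber.lean`). Everything is PROVED:

* **`K` is totally real**: the five real roots of `f`, the
  real embeddings `emb k : θ ↦ r k` (isolating intervals of width `10⁻⁸`), `r₂(K) = 0` (`nrComplexPlaces_eq_zero`).
* **`d_K = 241⁴`** (`discr_eq`): the integral basis `intBasis` of periods has Gram matrix
  `241·I - 48·J`, whose determinant is `241⁴` (matrix determinant lemma); hence the Minkowski bound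
  `M_K = (5!/5⁵)·241² = 2230.31…`, **`⌊M_K⌋ ≤ 2230`** (`floor_minkowskiBound_le`).
* **Dedekind–Kummer at every prime `p ∤ 176`**: `176·𝓞 K ⊆ ℤ[θ]` (`176·ηₖ = Pₖ(θ)`), so the
  Dedekind–Kummer exponent of `θ` divides a power of `176 = 2⁴·11` and Mathlib's
  `primesOverSpanEquivMonicFactorsMod` applies at odd `p ≠ 11`: if `f mod p` is irreducible, `(p)`
  is prime, the only prime above `p` (`span_natCast_of_irreducible`).
* **An irreducibility certificate for quintics over `𝔽_p`** (`QuinticRing.irreducible_poly_of_powCert`):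
  if `t^{p²} - t` is a unit of `𝔽_p[t]/(g)` (explicit inverse, `t^{p²}` by binary powering `powL`),
  the monic quintic `g` has no factor of degree `≤ 2`, hence is irreducible — a kernel-decidable test,
  packaged for `f` as `irreducible_quinticPolyMod_of_cert`.
* **Principal primes from norms**: an element `y` of the order with `normP y = ±p` (kernel identity)
  generates a prime of `𝓞 K` above `p` (`span_liftO_mem_primesOver`).

## References

* D. A. Marcus, *Number Fields*, 2nd ed. (2018), Ch. 2 (discriminant of an integral basis), Ch. 3,
  Thm. 27 (Dedekind–Kummer), Ch. 5, Cor. 2 of Thm. 37 (Minkowski bound). [folklore]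
* M. O. Rabin, *Probabilistic algorithms in finite fields*, SIAM J. Comput. 9 (1980) 273–280
  (irreducibility test via `gcd(g, X^{p^i} - X)`). [folklore]
* T. Dokchitser, V. Dokchitser, J. Number Theory 131 (2011) 1833–1839, proof of Thm. 2.
  [DokchitserDokchitser2011RankModN]
-/

noncomputable section

open Polynomial NumberField Ideal

namespace Literature.NumberTheory.NumberFields

/-! ### An irreducibility certificate for quintics over finite fields -/

namespace QuinticRing

variable {R : Type*} [CommRing R] {p0 p1 p2 p3 p4 : R}

/-- **Binary powering** along a list of bits (least significant first), computably:
`powL bs x = x ^ ofBits bs`. [folklore] -/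
def powL : List Bool → QuinticRing R p0 p1 p2 p3 p4 → QuinticRing R p0 p1 p2 p3 p4
  | [], _ => 1
  | b :: bs, x => (if b then x else 1) * powL bs (x * x)

/-- The number with binary digits `bs` (least significant first). [folklore] -/
def ofBits : List Bool → ℕ
  | [] => 0
  | b :: bs => (if b then 1 else 0) + 2 * ofBits bs

/-- The binary digits of `n` (least significant first), with fuel (structural recursion, so that the
kernel evaluates it). [folklore] -/
def bitsF : ℕ → ℕ → List Bool
  | 0, _ => []
  | fuel + 1, n => if n = 0 then [] else (n % 2 == 1) :: bitsF fuel (n / 2)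

/-- `powL bs x = x ^ ofBits bs`. [folklore] -/
theorem powL_eq_pow (bs : List Bool) (x : QuinticRing R p0 p1 p2 p3 p4) :
    powL bs x = x ^ ofBits bs := by
  induction bs generalizing x with
  | nil => simp [powL, ofBits]
  | cons b bs ih =>
    cases b
    · simp only [powL, ofBits, Bool.false_eq_true, ↓reduceIte, one_mul, ih, zero_add]
      rw [pow_mul, sq]
    · simp only [powL, ofBits, ↓reduceIte, ih]
      rw [pow_add, pow_one, pow_mul, sq]

/-- **Irreducibility of a monic quintic over a finite field by a power certificate.** If
`(t^{q²} - t) · s = 1` in `F[t]/(g)` (`q = |F|`, `g = poly p₀ … p₄`), then `g` is irreducible: a monic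
factor of degree `d ∈ {1, 2}` would have an irreducible factor `h` of degree `≤ 2`, and in the field
`F[t]/(h)` of cardinality `q^{deg h}` the class of `t` satisfies `t^{q²} = t` (as `deg h ∣ 2`), so the
unit `t^{q²} - t` would map to `0`. [folklore] -/
theorem irreducible_poly_of_powCert {F : Type*} [Field F] [Fintype F] (p0 p1 p2 p3 p4 : F)
    {bs : List Bool} (hbs : ofBits bs = Fintype.card F) (s : QuinticRing F p0 p1 p2 p3 p4)
    (h : (powL bs (powL bs (gen F p0 p1 p2 p3 p4)) - gen F p0 p1 p2 p3 p4) * s = 1) :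
    Irreducible (poly p0 p1 p2 p3 p4) := by
  classical
  set f : F[X] := poly p0 p1 p2 p3 p4 with hf
  have hmonic : f.Monic := monic_poly p0 p1 p2 p3 p4
  have hdeg : f.natDegree = 5 := natDegree_poly p0 p1 p2 p3 p4
  have hf1 : f ≠ 1 := fun h1 => by
    have := congrArg natDegree h1
    rw [hdeg, natDegree_one] at this
    exact absurd this (by norm_num)
  refine (hmonic.irreducible_iff_lt_natDegree_lt hf1).mpr fun q hq hqdeg hqdvd => ?_
  rw [hdeg, Finset.mem_Ioc] at hqdeg
  -- an irreducible factor `g` of `q`, of degree `1` or `2`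
  have hq1 : ¬ IsUnit q := fun hu => by
    rw [hq.isUnit_iff] at hu
    rw [hu, natDegree_one] at hqdeg
    exact absurd hqdeg.1 (lt_irrefl 0)
  obtain ⟨g, hgirr, hgq⟩ := WfDvdMonoid.exists_irreducible_factor hq1 hq.ne_zero
  have hg0 : g ≠ 0 := hgirr.ne_zero
  have hgdeg2 : g.natDegree ≤ 2 := (natDegree_le_of_dvd hgq hq.ne_zero).trans (by omega)
  have hgdeg1 : 1 ≤ g.natDegree := by
    rw [Nat.one_le_iff_ne_zero]
    intro h0
    rw [natDegree_eq_zero] at h0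
    obtain ⟨c, rfl⟩ := h0
    have hc : c ≠ 0 := fun hc => hg0 (by rw [hc, map_zero])
    exact hgirr.not_isUnit (isUnit_C.mpr (Ne.isUnit hc))
  -- the finite field `L = F[X]/(g)`
  haveI := Fact.mk hgirr
  haveI : Module.Finite F (AdjoinRoot g) := (AdjoinRoot.powerBasis hg0).finite
  haveI : Finite (AdjoinRoot g) := Module.finite_of_finite F
  letI : Fintype (AdjoinRoot g) := Fintype.ofFinite _
  have hcard : Fintype.card (AdjoinRoot g) = Fintype.card F ^ g.natDegree := by
    rw [Module.card_eq_pow_finrank (K := F), (AdjoinRoot.powerBasis hg0).finrank,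
      AdjoinRoot.powerBasis_dim]
  set r : AdjoinRoot g := AdjoinRoot.root g with hr
  have hrpow : r ^ Fintype.card (AdjoinRoot g) = r := FiniteField.pow_card r
  have hrq : (r ^ Fintype.card F) ^ Fintype.card F = r := by
    rw [← pow_mul]
    have h12 : g.natDegree = 1 ∨ g.natDegree = 2 := by omega
    rcases h12 with h1 | h2
    · rw [hcard, h1, pow_one] at hrpow
      rw [pow_mul, hrpow, hrpow]
    · rw [hcard, h2, sq] at hrpow
      exact hrpow
  -- the homomorphism `F[t]/(f) → L`, `t ↦ r`
  have hgf : g ∣ f := hgq.trans hqdvd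
  have hev : f.eval₂ (AdjoinRoot.of g) r = 0 := by
    rw [hr, ← AdjoinRoot.algebraMap_eq, ← aeval_def, AdjoinRoot.aeval_eq, AdjoinRoot.mk_eq_zero]
    exact hgf
  let φ : QuinticRing F p0 p1 p2 p3 p4 →+* AdjoinRoot g :=
    (AdjoinRoot.lift (AdjoinRoot.of g) r hev).comp toAdjHom
  have hφ : φ (gen F p0 p1 p2 p3 p4) = r := by
    show AdjoinRoot.lift (AdjoinRoot.of g) r hev (toAdj p0 p1 p2 p3 p4 (gen F p0 p1 p2 p3 p4)) = r
    rw [toAdj_gen, AdjoinRoot.lift_root]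
  have key := congrArg φ h
  rw [map_mul, map_sub, powL_eq_pow, powL_eq_pow, map_pow, map_pow, hφ, hbs, hrq, sub_self,
    zero_mul, map_one] at key
  exact zero_ne_one key

end QuinticRing

namespace CyclicQuintic241

open PeriodRing241 (shift const normP trP)

/-! ### The five real roots and the real embeddings; `K` is totally real -/

/-- The real quintic function `p(x) = x⁵ + x⁴ - 96x³ - 212x² + 1232x + 512`. [folklore] -/
def preal (x : ℝ) : ℝ := x ^ 5 + x ^ 4 - 96 * x ^ 3 - 212 * x ^ 2 + 1232 * x + 512

/-- `p` is continuous. [folklore] -/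
theorem continuous_preal : Continuous preal := by unfold preal; fun_prop

/-- `f` has a real root in each of five intervals of width `10⁻⁸` around
`η₀ ≈ 9.720743748, η₁ ≈ -0.393681152, η₂ ≈ 3.015021396, η₃ ≈ -6.313131748, η₄ ≈ -7.028952244`.
[folklore] -/
theorem exists_roots_preal :
    (∃ r, r ∈ Set.Ioo (972074374 / 100000000 : ℝ) (972074375 / 100000000) ∧ preal r = 0) ∧
    (∃ r, r ∈ Set.Ioo (-39368116 / 100000000 : ℝ) (-39368115 / 100000000) ∧ preal r = 0) ∧
    (∃ r, r ∈ Set.Ioo (301502139 / 100000000 : ℝ) (301502140 / 100000000) ∧ preal r = 0) ∧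
    (∃ r, r ∈ Set.Ioo (-631313175 / 100000000 : ℝ) (-631313174 / 100000000) ∧ preal r = 0) ∧
    (∃ r, r ∈ Set.Ioo (-702895225 / 100000000 : ℝ) (-702895224 / 100000000) ∧ preal r = 0) := by
  refine ⟨?_, ?_, ?_, ?_, ?_⟩
  · have h := intermediate_value_Ioo (show (972074374 / 100000000 : ℝ) ≤ 972074375 / 100000000 by norm_num)
      continuous_preal.continuousOn
    have h0 : (0 : ℝ) ∈ Set.Ioo (preal (972074374 / 100000000)) (preal (972074375 / 100000000)) := by
      simp only [preal, Set.mem_Ioo]; norm_num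
    obtain ⟨r, hr, hr0⟩ := h h0
    exact ⟨r, hr, hr0⟩
  · have h := intermediate_value_Ioo (show (-39368116 / 100000000 : ℝ) ≤ -39368115 / 100000000 by norm_num)
      continuous_preal.continuousOn
    have h0 : (0 : ℝ) ∈ Set.Ioo (preal (-39368116 / 100000000)) (preal (-39368115 / 100000000)) := by
      simp only [preal, Set.mem_Ioo]; norm_num
    obtain ⟨r, hr, hr0⟩ := h h0
    exact ⟨r, hr, hr0⟩
  · have h := intermediate_value_Ioo' (show (301502139 / 100000000 : ℝ) ≤ 301502140 / 100000000 by norm_num)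
      continuous_preal.continuousOn
    have h0 : (0 : ℝ) ∈ Set.Ioo (preal (301502140 / 100000000)) (preal (301502139 / 100000000)) := by
      simp only [preal, Set.mem_Ioo]; norm_num
    obtain ⟨r, hr, hr0⟩ := h h0
    exact ⟨r, hr, hr0⟩
  · have h := intermediate_value_Ioo' (show (-631313175 / 100000000 : ℝ) ≤ -631313174 / 100000000 by norm_num)
      continuous_preal.continuousOn
    have h0 : (0 : ℝ) ∈ Set.Ioo (preal (-631313174 / 100000000)) (preal (-631313175 / 100000000)) := by
      simp only [preal, Set.mem_Ioo]; norm_num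
    obtain ⟨r, hr, hr0⟩ := h h0
    exact ⟨r, hr, hr0⟩
  · have h := intermediate_value_Ioo (show (-702895225 / 100000000 : ℝ) ≤ -702895224 / 100000000 by norm_num)
      continuous_preal.continuousOn
    have h0 : (0 : ℝ) ∈ Set.Ioo (preal (-702895225 / 100000000)) (preal (-702895224 / 100000000)) := by
      simp only [preal, Set.mem_Ioo]; norm_num
    obtain ⟨r, hr, hr0⟩ := h h0
    exact ⟨r, hr, hr0⟩

/-- The root `r₀ ≈ 9.72074` (`= η₀`). [folklore] -/
def r₀ : ℝ := Classical.choose exists_roots_preal.1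
/-- The root `r₁ ≈ -0.39368` (`= η₁`). [folklore] -/
def r₁ : ℝ := Classical.choose exists_roots_preal.2.1
/-- The root `r₂ ≈ 3.01502` (`= η₂`). [folklore] -/
def r₂ : ℝ := Classical.choose exists_roots_preal.2.2.1
/-- The root `r₃ ≈ -6.31313` (`= η₃`). [folklore] -/
def r₃ : ℝ := Classical.choose exists_roots_preal.2.2.2.1
/-- The root `r₄ ≈ -7.02895` (`= η₄`). [folklore] -/
def r₄ : ℝ := Classical.choose exists_roots_preal.2.2.2.2

/-- `r₀ ∈ (9.72074374, 9.72074375)`, `p(r₀) = 0`. [folklore] -/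
theorem r₀_spec : r₀ ∈ Set.Ioo (972074374 / 100000000 : ℝ) (972074375 / 100000000) ∧ preal r₀ = 0 :=
  Classical.choose_spec exists_roots_preal.1
/-- `r₁ ∈ (-0.39368116, -0.39368115)`, `p(r₁) = 0`. [folklore] -/
theorem r₁_spec : r₁ ∈ Set.Ioo (-39368116 / 100000000 : ℝ) (-39368115 / 100000000) ∧ preal r₁ = 0 :=
  Classical.choose_spec exists_roots_preal.2.1
/-- `r₂ ∈ (3.01502139, 3.01502140)`, `p(r₂) = 0`. [folklore] -/
theorem r₂_spec : r₂ ∈ Set.Ioo (301502139 / 100000000 : ℝ) (301502140 / 100000000) ∧ preal r₂ = 0 :=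
  Classical.choose_spec exists_roots_preal.2.2.1
/-- `r₃ ∈ (-6.31313175, -6.31313174)`, `p(r₃) = 0`. [folklore] -/
theorem r₃_spec : r₃ ∈ Set.Ioo (-631313175 / 100000000 : ℝ) (-631313174 / 100000000) ∧ preal r₃ = 0 :=
  Classical.choose_spec exists_roots_preal.2.2.2.1
/-- `r₄ ∈ (-7.02895225, -7.02895224)`, `p(r₄) = 0`. [folklore] -/
theorem r₄_spec : r₄ ∈ Set.Ioo (-702895225 / 100000000 : ℝ) (-702895224 / 100000000) ∧ preal r₄ = 0 :=
  Classical.choose_spec exists_roots_preal.2.2.2.2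

/-- The five real roots as a family (`r k ≈ ηₖ`). [folklore] -/
def r : Fin 5 → ℝ := ![r₀, r₁, r₂, r₃, r₄]

/-- Each `r k` is a root of `p`. [folklore] -/
theorem preal_r (k : Fin 5) : preal (r k) = 0 := by
  fin_cases k
  exacts [r₀_spec.2, r₁_spec.2, r₂_spec.2, r₃_spec.2, r₄_spec.2]

/-- The roots are pairwise distinct. [folklore] -/
theorem r_injective : Function.Injective r := by
  have h0 := r₀_spec.1; have h1 := r₁_spec.1; have h2 := r₂_spec.1; have h3 := r₃_spec.1
  have h4 := r₄_spec.1
  simp only [Set.mem_Ioo] at h0 h1 h2 h3 h4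
  intro i j hij
  fin_cases i <;> fin_cases j <;> first | rfl | (exfalso; simp [r] at hij; linarith)

/-- `quinticPolyRat` evaluated in `ℝ` is `p`. [folklore] -/
theorem eval₂_quinticPolyRat_eq_preal (x : ℝ) : quinticPolyRat.eval₂ (algebraMap ℚ ℝ) x = preal x := by
  rw [eval₂_map, quinticPoly]
  simp only [eval₂_add, eval₂_sub, eval₂_mul, eval₂_X_pow, eval₂_X, eval₂_ofNat, map_ofNat]
  rfl

/-- A real root of `p` is a root of `quinticPolyRat` under `ℚ → ℝ`. [folklore] -/
theorem eval₂_quinticPolyRat_real {x : ℝ} (hx : preal x = 0) :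
    quinticPolyRat.eval₂ (algebraMap ℚ ℝ) x = 0 := by
  rw [eval₂_quinticPolyRat_eq_preal, hx]

/-- The explicit real polynomial `P ∈ ℝ[X]` with `P(x) = p(x)`. [folklore] -/
def Preal : ℝ[X] := X ^ 5 + X ^ 4 - 96 * X ^ 3 - 212 * X ^ 2 + 1232 * X + 512

/-- `P(x) = p(x)`. [folklore] -/
theorem eval_Preal (x : ℝ) : Preal.eval x = preal x := by
  simp only [Preal, preal, eval_add, eval_sub, eval_mul, eval_pow, eval_X, eval_ofNat]

/-- `deg P = 5`. [folklore] -/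
theorem natDegree_Preal : Preal.natDegree = 5 := by
  unfold Preal; compute_degree!

/-- `P ≠ 0`. [folklore] -/
theorem Preal_ne_zero : Preal ≠ 0 := fun h => by
  have := natDegree_Preal; rw [h, natDegree_zero] at this; exact absurd this (by norm_num)

/-- **The five roots are all the real roots of `f`** (five distinct roots of a quintic).
(Verbatim the tree's `CyclicQuintic11.root_cases`.) [folklore] -/
theorem root_cases {x : ℝ} (hx : preal x = 0) : x = r₀ ∨ x = r₁ ∨ x = r₂ ∨ x = r₃ ∨ x = r₄ := by
  classical
  have h0 := r₀_spec.1; have h1 := r₁_spec.1; have h2 := r₂_spec.1; have h3 := r₃_spec.1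
  have h4 := r₄_spec.1
  simp only [Set.mem_Ioo] at h0 h1 h2 h3 h4
  set S : Finset ℝ := {r₀, r₁, r₂, r₃, r₄} with hS
  have hScard : S.card = 5 := by
    rw [hS, Finset.card_insert_of_notMem, Finset.card_insert_of_notMem,
      Finset.card_insert_of_notMem, Finset.card_insert_of_notMem, Finset.card_singleton]
    · rw [Finset.mem_singleton]; linarith
    · simp only [Finset.mem_insert, Finset.mem_singleton, not_or]; constructor <;> linarith
    · simp only [Finset.mem_insert, Finset.mem_singleton, not_or]
      refine ⟨?_, ?_, ?_⟩ <;> linarith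
    · simp only [Finset.mem_insert, Finset.mem_singleton, not_or]
      refine ⟨?_, ?_, ?_, ?_⟩ <;> linarith
  have hmem : ∀ y, preal y = 0 → y ∈ Preal.roots.toFinset := fun y hy => by
    rw [Multiset.mem_toFinset, mem_roots Preal_ne_zero, IsRoot.def, eval_Preal]; exact hy
  have hsub : S ⊆ Preal.roots.toFinset := by
    intro y hy
    simp only [hS, Finset.mem_insert, Finset.mem_singleton] at hy
    rcases hy with rfl | rfl | rfl | rfl | rfl
    exacts [hmem _ r₀_spec.2, hmem _ r₁_spec.2, hmem _ r₂_spec.2, hmem _ r₃_spec.2,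
      hmem _ r₄_spec.2]
  have hcard : Preal.roots.toFinset.card ≤ S.card := by
    rw [hScard, ← natDegree_Preal]
    exact (Multiset.toFinset_card_le _).trans (Polynomial.card_roots' _)
  have heq : S = Preal.roots.toFinset := Finset.eq_of_subset_of_card_le hsub hcard
  have hxS : x ∈ S := by rw [heq]; exact hmem x hx
  simpa [hS] using hxS

/-- A ring homomorphism `K = ℚ(θ) → ℝ` is determined by the image of `θ`. [folklore] -/
theorem ringHom_real_ext {g h : K →+* ℝ} (hgh : g θ = h θ) : g = h := by
  have : (g.toRatAlgHom : K →ₐ[ℚ] ℝ) = h.toRatAlgHom := AdjoinRoot.algHom_ext (by exact hgh)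
  have := congrArg (fun f : K →ₐ[ℚ] ℝ => (f : K →+* ℝ)) this
  simpa using this

/-- **The real embedding `emb k : K → ℝ`, `θ ↦ r k`.** [folklore] -/
def emb (k : Fin 5) : K →+* ℝ :=
  AdjoinRoot.lift (algebraMap ℚ ℝ) (r k) (eval₂_quinticPolyRat_real (preal_r k))

/-- `emb k θ = r k`. [folklore] -/
@[simp] theorem emb_θ (k : Fin 5) : emb k θ = r k := AdjoinRoot.lift_root _

/-- The five real embeddings are pairwise distinct. [folklore] -/
theorem emb_injective : Function.Injective emb := fun i j hij =>
  r_injective (by rw [← emb_θ, ← emb_θ, hij])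

/-- The real embeddings give real complex embeddings. [folklore] -/
theorem isReal_ofReal_comp_emb (k : Fin 5) :
    ComplexEmbedding.IsReal (Complex.ofRealHom.comp (emb k)) :=
  ComplexEmbedding.isReal_iff.mpr (RingHom.ext fun x => by
    simp [ComplexEmbedding.conjugate_coe_eq, Complex.conj_ofReal])

/-- **`K` is totally real**: `r₂(K) = 0`. [folklore] -/
theorem nrComplexPlaces_eq_zero : InfinitePlace.nrComplexPlaces K = 0 := by
  classical
  have h5 : 5 ≤ InfinitePlace.nrRealPlaces K := by
    rw [← InfinitePlace.card_real_embeddings]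
    let ι : Fin 5 → {φ : K →+* ℂ // ComplexEmbedding.IsReal φ} :=
      fun k => ⟨Complex.ofRealHom.comp (emb k), isReal_ofReal_comp_emb k⟩
    have hι : Function.Injective ι := by
      intro i j hij
      apply emb_injective
      have h := congrArg (fun φ : {φ : K →+* ℂ // ComplexEmbedding.IsReal φ} => φ.1) hij
      exact RingHom.ext fun x => Complex.ofReal_injective (RingHom.congr_fun h x)
    simpa using Fintype.card_le_of_injective ι hι
  have h := InfinitePlace.card_add_two_mul_card_eq_rank K
  rw [finrank_K] at h
  omega

/-! ### The integral basis of periods; `d_K = 241⁴`; the Minkowski bound -/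

/-- Coordinates on the order of periods, as a `ℤ`-linear equivalence with `ℤ⁵`. [folklore] -/
def coordEquiv : PeriodRing241 ℤ ≃ₗ[ℤ] (Fin 5 → ℤ) where
  toFun u := ![u.c0, u.c1, u.c2, u.c3, u.c4]
  invFun v := ⟨v 0, v 1, v 2, v 3, v 4⟩
  map_add' u v := by ext i; fin_cases i <;> rfl
  map_smul' n u := by ext i; fin_cases i <;> simp [-zsmul_eq_mul]
  left_inv u := rfl
  right_inv v := by ext i; fin_cases i <;> rfl

/-- The coordinate basis `ηₖ` of the order of periods. [folklore] -/
def basisP : Module.Basis (Fin 5) ℤ (PeriodRing241 ℤ) := Module.Basis.ofEquivFun coordEquiv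

/-- `basisP k = ηₖ`. [folklore] -/
theorem basisP_apply (k : Fin 5) : basisP k = PeriodRing241.eta k := by
  classical
  rw [basisP, Module.Basis.coe_ofEquivFun]
  fin_cases k <;> (ext <;> simp [coordEquiv, PeriodRing241.eta])

/-- **The integral basis of Gaussian periods** of `𝓞 K` (transport of `basisP` along
`integerEquiv`). [folklore] -/
def intBasis : Module.Basis (Fin 5) ℤ (𝓞 K) :=
  basisP.map integerEquiv.toAddEquiv.toIntLinearEquiv

/-- `intBasis k = e241 k`. [folklore] -/
theorem coe_intBasis (k : Fin 5) : ((intBasis k : 𝓞 K) : K) = e241 k := by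
  rw [intBasis, Module.Basis.map_apply, basisP_apply]
  exact coe_integerEquiv_eta k

/-- The Gram matrix of the trace form on the periods is `241·(1 + c r)` with `c ≡ -48/241`, `r ≡ 1`.
[folklore] -/
theorem traceMatrix_eq :
    Algebra.traceMatrix ℚ (fun k => e241 k) =
      (241 : ℚ) • (1 + Matrix.replicateCol (Fin 1) (fun _ : Fin 5 => (-48 / 241 : ℚ)) *
        Matrix.replicateRow (Fin 1) (fun _ : Fin 5 => (1 : ℚ))) := by
  ext i j
  rw [Algebra.traceMatrix_apply, Algebra.traceForm_apply, trace_e241_mul]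
  simp [Matrix.mul_apply, Matrix.one_apply]
  split_ifs <;> norm_num

/-- **`d_K = 241⁴ = 3373402561`.** [folklore] -/
theorem discr_eq : NumberField.discr K = 3373402561 := by
  classical
  have h1 : (NumberField.discr K : ℚ) = Algebra.discr ℚ (fun k => e241 k) := by
    rw [← NumberField.discr_eq_discr K intBasis, ← eq_intCast (algebraMap ℤ ℚ),
      ← Algebra.discr_localizationLocalization ℤ (nonZeroDivisors ℤ) K intBasis]
    congr 1
    ext k
    rw [Module.Basis.localizationLocalization_apply, ← coe_intBasis k]
  have h2 : Algebra.discr ℚ (fun k => e241 k) = 3373402561 := by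
    rw [Algebra.discr_def, traceMatrix_eq, Matrix.det_smul, Matrix.det_one_add_mul_comm,
      Matrix.det_unique, Fintype.card_fin]
    simp [Matrix.mul_apply]
    norm_num
  exact_mod_cast h1.trans h2

/-- `|d_K| = 241⁴`. [folklore] -/
theorem abs_discr_eq : |NumberField.discr K| = 3373402561 := by
  rw [discr_eq]; rfl

/-- **`⌊M_K⌋ ≤ 2230`**: `M_K = (4/π)⁰ · (5!/5⁵) · √(241⁴) = 120 · 58081 / 3125 = 2230.31…`.
[folklore] -/
theorem floor_minkowskiBound_le :
    ⌊(4 / Real.pi) ^ InfinitePlace.nrComplexPlaces K *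
        ((Module.finrank ℚ K).factorial / (Module.finrank ℚ K : ℝ) ^ Module.finrank ℚ K *
          Real.sqrt |(NumberField.discr K : ℝ)|)⌋₊ ≤ 2230 := by
  have hsqrt : Real.sqrt |(NumberField.discr K : ℝ)| = 58081 := by
    have h : |(NumberField.discr K : ℝ)| = 3373402561 := by exact_mod_cast abs_discr_eq
    rw [h, show (3373402561 : ℝ) = 58081 ^ 2 by norm_num, Real.sqrt_sq (by norm_num)]
  rw [nrComplexPlaces_eq_zero, finrank_K, hsqrt, pow_zero, one_mul]
  have hfac : ((5 : ℕ).factorial : ℝ) = 120 := by norm_num [Nat.factorial]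
  rw [hfac]
  refine Nat.le_of_lt_succ ((Nat.floor_lt (by positivity)).mpr ?_)
  norm_num

/-! ### `θ` as an algebraic integer; `176 · 𝓞 K ⊆ ℤ[θ]`; Dedekind–Kummer away from `176` -/

/-- `θ` as an element of `𝓞 K`. [folklore] -/
def θint : 𝓞 K := ⟨θ, isIntegral_θ⟩

/-- The coercion of `θint` to `K` is `θ`. [folklore] -/
@[simp] theorem coe_θint : ((θint : 𝓞 K) : K) = θ := rfl

/-- `minpoly_ℤ θint = f`. [folklore] -/
theorem minpoly_θint : minpoly ℤ θint = quinticPoly := by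
  rw [← RingOfIntegers.minpoly_coe, coe_θint]
  exact minpoly_int_θ

/-- The integer polynomials `Pₖ` with `176 ηₖ = Pₖ(θ)` (`P₀ = 176 X`). [folklore] -/
def Pk (k : Fin 5) : ℤ[X] :=
  match k with
  | 0 => C 176 * X
  | 1 => C 736 + C 400 * X + C (-318) * X ^ 2 + C (-21) * X ^ 3 + C 5 * X ^ 4
  | 2 => C (-1392) + C (-636) * X + C 204 * X ^ 2 + C 17 * X ^ 3 + C (-3) * X ^ 4
  | 3 => C (-992) + C 668 * X + C 112 * X ^ 2 + C (-9) * X ^ 3 + C (-1) * X ^ 4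
  | 4 => C 1472 + C (-608) * X + C 2 * X ^ 2 + C 13 * X ^ 3 + C (-1) * X ^ 4

/-- `Pₖ(θ) = 176 · e241 k` in `K`. [folklore] -/
theorem aeval_θ_Pk (k : Fin 5) : aeval θ (Pk k) = 176 * e241 k := by
  fin_cases k <;>
    simp only [Pk, e241, map_add, map_mul, map_neg, map_ofNat, map_one, aeval_X, aeval_X_pow] <;>
    ring

/-- The periods as elements of `𝓞 K`. [folklore] -/
def e241O (k : Fin 5) : 𝓞 K := ⟨e241 k, isIntegral_e241 k⟩

/-- `(e241O k : K) = e241 k`. [folklore] -/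
@[simp] theorem coe_e241O (k : Fin 5) : ((e241O k : 𝓞 K) : K) = e241 k := rfl

/-- `(Q(θint) : K) = Q(θ)`. [folklore] -/
theorem coe_aeval_θint (Q : ℤ[X]) : ((aeval θint Q : 𝓞 K) : K) = aeval θ Q := by
  rw [RingOfIntegers.coe_eq_algebraMap, ← aeval_algebraMap_apply]
  rfl

/-- `176 · e241O k = Pₖ(θint)` in `𝓞 K`. [folklore] -/
theorem mul_e241O_eq (k : Fin 5) : (176 : 𝓞 K) * e241O k = aeval θint (Pk k) := by
  apply RingOfIntegers.ext
  simp only [map_mul, coe_e241O, coe_aeval_θint, aeval_θ_Pk, map_ofNat]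

/-- **`176 · x ∈ ℤ[θ]` for every `x ∈ 𝓞 K`** (`x = Σ yₖ ηₖ`, `176 ηₖ = Pₖ(θ)`): the conductor of
`ℤ[θ]` contains `176 = 2⁴·11`. [folklore] -/
theorem mul_mem_adjoin (x : 𝓞 K) : 176 * x ∈ Algebra.adjoin ℤ ({θint} : Set (𝓞 K)) := by
  obtain ⟨y, hy⟩ := exists_liftK_eq_of_isIntegral x.isIntegral_coe
  have hx : 176 * x = (y.c0 : 𝓞 K) * aeval θint (Pk 0) + (y.c1 : 𝓞 K) * aeval θint (Pk 1) +
      (y.c2 : 𝓞 K) * aeval θint (Pk 2) + (y.c3 : 𝓞 K) * aeval θint (Pk 3) +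
      (y.c4 : 𝓞 K) * aeval θint (Pk 4) := by
    simp only [← mul_e241O_eq]
    apply RingOfIntegers.ext
    simp only [map_mul, map_add, coe_e241O, map_ofNat, map_intCast]
    rw [← hy, liftK, PeriodRing241.lift_apply, PeriodRing241.liftFun]
    ring
  rw [hx]
  have hmem : ∀ k, aeval θint (Pk k) ∈ Algebra.adjoin ℤ ({θint} : Set (𝓞 K)) := fun k =>
    Polynomial.aeval_mem_adjoin_singleton ℤ θint
  have hc : ∀ n : ℤ, (n : 𝓞 K) ∈ Algebra.adjoin ℤ ({θint} : Set (𝓞 K)) := fun n =>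
    Subalgebra.intCast_mem _ n
  refine Subalgebra.add_mem _ (Subalgebra.add_mem _ (Subalgebra.add_mem _ (Subalgebra.add_mem _
    (Subalgebra.mul_mem _ (hc _) (hmem 0)) (Subalgebra.mul_mem _ (hc _) (hmem 1)))
    (Subalgebra.mul_mem _ (hc _) (hmem 2))) (Subalgebra.mul_mem _ (hc _) (hmem 3)))
    (Subalgebra.mul_mem _ (hc _) (hmem 4))

/-- `176 ∈ 𝔣_θ`, the conductor of `ℤ[θ]` in `𝓞 K`. [folklore] -/
theorem mem_conductor : (176 : 𝓞 K) ∈ conductor ℤ θint := fun b => by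
  simpa using mul_mem_adjoin b

/-- **The Dedekind–Kummer exponent of `θ` is prime to every `p` coprime to `176`.** [folklore] -/
theorem not_dvd_exponent {p : ℕ} [hp : Fact p.Prime] (hcop : Nat.Coprime 176 p) :
    ¬ p ∣ RingOfIntegers.exponent θint := by
  rw [RingOfIntegers.not_dvd_exponent_iff]
  have h176 : Ideal.span {(176 : ℤ)} ≤ Ideal.comap (algebraMap ℤ (𝓞 K)) (conductor ℤ θint) := by
    rw [Ideal.span_singleton_le_iff_mem, Ideal.mem_comap, map_ofNat]
    exact mem_conductor
  refine Codisjoint.mono_left h176 ?_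
  rw [← Ideal.isCoprime_iff_codisjoint, Ideal.isCoprime_span_singleton_iff,
    Int.isCoprime_iff_gcd_eq_one]
  exact hcop

/-- `f mod p ∈ 𝔽_p[X]`. [folklore] -/
def quinticPolyMod (p : ℕ) : (ZMod p)[X] := quinticPoly.map (Int.castRingHom (ZMod p))

/-- `f mod p` is monic. [folklore] -/
theorem monic_quinticPolyMod (p : ℕ) [Fact p.Prime] : (quinticPolyMod p).Monic :=
  quinticPoly_monic.map _

/-- `deg (f mod p) = 5`. [folklore] -/
theorem natDegree_quinticPolyMod (p : ℕ) [Fact p.Prime] : (quinticPolyMod p).natDegree = 5 := by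
  rw [quinticPolyMod, quinticPoly_monic.natDegree_map, quinticPoly_natDegree]

/-- `f mod p` in the normal form `QuinticRing.poly (-512) (-1232) 212 96 (-1)`. [folklore] -/
theorem quinticPolyMod_eq (p : ℕ) :
    quinticPolyMod p = QuinticRing.poly (-512 : ZMod p) (-1232) 212 96 (-1) := by
  simp only [quinticPolyMod, quinticPoly, QuinticRing.poly, Polynomial.map_add,
    Polynomial.map_sub, Polynomial.map_mul, Polynomial.map_pow, map_X, Polynomial.map_ofNat,
    map_neg, map_one, map_ofNat]
  ring

/-- **Dedekind–Kummer for `θ` at `p ∤ 176`**: a prime `P` of `𝓞 K` above `p` corresponds to a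
monic irreducible factor of `f mod p`, of residue degree its degree, and `P = (p, Q(θ))` for any
lift `Q`. Verbatim the tree's `CyclicQuintic11.exists_factor_of_mem_primesOver` with the exponent
hypothesis supplied by `not_dvd_exponent`. [folklore] -/
theorem exists_factor_of_mem_primesOver {p : ℕ} (hp : p.Prime) (hcop : Nat.Coprime 176 p)
    {P : Ideal (𝓞 K)} (hP : P ∈ primesOver (span {(p : ℤ)}) (𝓞 K)) :
    ∃ Qb : (ZMod p)[X], Irreducible Qb ∧ Qb.Monic ∧ Qb ∣ quinticPolyMod p ∧
      P.inertiaDeg ℤ = Qb.natDegree ∧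
      ∀ Q : ℤ[X], Q.map (Int.castRingHom (ZMod p)) = Qb → P = span {(p : 𝓞 K), aeval θint Q} := by
  haveI := Fact.mk hp
  have hexp : ¬ p ∣ RingOfIntegers.exponent θint := not_dvd_exponent hcop
  set e := NumberField.Ideal.primesOverSpanEquivMonicFactorsMod (K := K) hexp with he
  set Qb := e ⟨P, hP⟩ with hQb
  have hmem : (Qb : (ZMod p)[X]) ∈ RingOfIntegers.monicFactorsMod θint p := Qb.2
  have hmem' := hmem
  simp only [RingOfIntegers.monicFactorsMod, Multiset.mem_toFinset, minpoly_θint] at hmem'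
  have h0 : quinticPolyMod p ≠ 0 := (monic_quinticPolyMod p).ne_zero
  obtain ⟨hirr, hmon, hdvd⟩ := (Polynomial.mem_normalizedFactors_iff h0).mp hmem'
  refine ⟨Qb, hirr, hmon, hdvd, ?_, ?_⟩
  · have := NumberField.Ideal.inertiaDeg_primesOverSpanEquivMonicFactorsMod_symm_apply' hexp hmem
    rwa [show (⟨(Qb : (ZMod p)[X]), hmem⟩ : RingOfIntegers.monicFactorsMod θint p) = Qb
      from Subtype.ext rfl, Equiv.symm_apply_apply] at this
  · intro Q hQ
    have hmemQ : Q.map (Int.castRingHom (ZMod p)) ∈ RingOfIntegers.monicFactorsMod θint p := hQ ▸ hmem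
    have h1 := NumberField.Ideal.primesOverSpanEquivMonicFactorsMod_symm_apply_eq_span hexp hmemQ
    have h2 : (⟨Q.map (Int.castRingHom (ZMod p)), hmemQ⟩ :
        RingOfIntegers.monicFactorsMod θint p) = Qb := Subtype.ext hQ
    rw [h2, hQb, Equiv.symm_apply_apply] at h1
    exact h1

/-- `θint` is a root of `f` in `𝓞 K`. [folklore] -/
theorem aeval_θint : aeval θint quinticPoly = 0 := by
  apply IsFractionRing.injective (𝓞 K) K
  rw [map_zero, ← aeval_algebraMap_apply]
  exact aeval_θ_quinticPoly

/-- **Inert primes**: if `p ∤ 176` and `f mod p` is irreducible, every prime of `𝓞 K` above `p` is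
`(p)`, of residue degree `5`. [folklore] -/
theorem eq_span_of_irreducible {p : ℕ} (hp : p.Prime) (hcop : Nat.Coprime 176 p) {P : Ideal (𝓞 K)}
    (hP : P ∈ primesOver (span {(p : ℤ)}) (𝓞 K)) (hfirr : Irreducible (quinticPolyMod p)) :
    P = span {(p : 𝓞 K)} ∧ P.inertiaDeg ℤ = 5 := by
  haveI := Fact.mk hp
  obtain ⟨Qb, hirr, hmon, hdvd, hdeg, hspan⟩ := exists_factor_of_mem_primesOver hp hcop hP
  have hQb : Qb = quinticPolyMod p :=
    eq_of_monic_of_associated hmon (monic_quinticPolyMod p) (hirr.associated_of_dvd hfirr hdvd)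
  refine ⟨?_, by rw [hdeg, hQb, natDegree_quinticPolyMod]⟩
  have h := hspan quinticPoly (by rw [hQb]; rfl)
  rw [aeval_θint] at h
  rw [h, Ideal.span_insert, Ideal.span_singleton_eq_bot.mpr rfl, sup_bot_eq]

/-- **The prime `(p)` for an inert `p ∤ 176`**: prime, of residue degree `5`, the only prime above `p`.
[folklore] -/
theorem span_natCast_of_irreducible {p : ℕ} (hp : p.Prime) (hcop : Nat.Coprime 176 p)
    (hfirr : Irreducible (quinticPolyMod p)) :
    (span {(p : 𝓞 K)}).IsPrime ∧ (span {(p : 𝓞 K)}).inertiaDeg ℤ = 5 ∧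
      span {(p : 𝓞 K)} ∈ primesOver (span {(p : ℤ)}) (𝓞 K) ∧
      ∀ P ∈ primesOver (span {(p : ℤ)}) (𝓞 K), P = span {(p : 𝓞 K)} := by
  haveI : Fact (Nat.Prime p) := ⟨hp⟩
  haveI : (span {(p : ℤ)}).IsPrime := (Int.ideal_span_isMaximal_of_prime p).isPrime
  obtain ⟨⟨P, hP⟩⟩ := Ideal.nonempty_primesOver (S := 𝓞 K) (span {(p : ℤ)})
  obtain ⟨hPeq, hdeg⟩ := eq_span_of_irreducible hp hcop hP hfirr
  subst hPeq
  exact ⟨hP.1, hdeg, hP, fun Q hQ => (eq_span_of_irreducible hp hcop hQ hfirr).1⟩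

/-- **The irreducibility certificate for `f mod p`**: with `bs` the binary digits of `p` and
`s ∈ 𝔽_p[t]/(f)` an inverse of `t^{p²} - t`, `f mod p` is irreducible
(`QuinticRing.irreducible_poly_of_powCert`). [folklore] -/
theorem irreducible_quinticPolyMod_of_cert (p : ℕ) [Fact p.Prime] {bs : List Bool}
    (hbs : QuinticRing.ofBits bs = p) (s : QuinticRing (ZMod p) (-512) (-1232) 212 96 (-1))
    (h : (QuinticRing.powL bs (QuinticRing.powL bs (QuinticRing.gen (ZMod p) (-512) (-1232) 212 96 (-1)))
      - QuinticRing.gen (ZMod p) (-512) (-1232) 212 96 (-1)) * s = 1) :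
    Irreducible (quinticPolyMod p) := by
  rw [quinticPolyMod_eq]
  exact QuinticRing.irreducible_poly_of_powCert _ _ _ _ _ (by rw [hbs, ZMod.card]) s h

/-! ### Principal primes from elements of prime norm -/

/-- `N_ℤ(liftO y) = m` if `normP y = const m` (kernel-computable norms in `𝓞 K`). [folklore] -/
theorem norm_liftO_of_normP_eq {y : PeriodRing241 ℤ} {m : ℤ} (h : normP y = const m) :
    Algebra.norm ℤ (liftO y) = m := by
  have h1 := Algebra.coe_norm_int (liftO y)
  rw [coe_liftO, norm_liftK_of_normP_eq h] at h1
  exact_mod_cast h1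

/-- A prime ideal of `𝓞 K` containing the rational prime `p` lies above `p`. [folklore] -/
theorem mem_primesOver_of_mem {p : ℕ} (hp : p.Prime) {P : Ideal (𝓞 K)} [hP : P.IsPrime]
    (hmem : (p : 𝓞 K) ∈ P) : P ∈ primesOver (span {(p : ℤ)}) (𝓞 K) := by
  haveI : Fact p.Prime := ⟨hp⟩
  refine ⟨hP, ⟨?_⟩⟩
  refine (Int.ideal_span_isMaximal_of_prime p).eq_of_le (Ideal.comap_ne_top _ hP.ne_top) ?_
  rw [Ideal.span_singleton_le_iff_mem, Ideal.mem_comap, map_natCast]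
  exact hmem

/-- **An element of norm `±p` generates a prime above `p`**: if `normP y = ±p` (kernel identity in
the order of periods), `(liftO y)` is a (principal) prime of `𝓞 K` above `p`, of norm `p`.
[folklore] -/
theorem span_liftO_mem_primesOver {p : ℕ} (hp : p.Prime) {y : PeriodRing241 ℤ}
    (h : normP y = const (p : ℤ) ∨ normP y = const (-(p : ℤ))) :
    span {liftO y} ∈ primesOver (span {(p : ℤ)}) (𝓞 K) ∧ absNorm (span {liftO y}) = p := by
  have hN : absNorm (span {liftO y}) = p := by
    rw [absNorm_span_singleton]
    rcases h with h | h <;> rw [norm_liftO_of_normP_eq h] <;> simp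
  haveI : (span {liftO y}).IsPrime := isPrime_of_irreducible_absNorm (hN ▸ hp)
  refine ⟨mem_primesOver_of_mem hp ?_, hN⟩
  have := absNorm_mem (span {liftO y})
  rwa [hN] at this

end CyclicQuintic241

end Literature.NumberTheory.NumberFields

end
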